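import Summits.QuantumFields.BalabanUV.Beta.GAN24.DerivativeRateTransferJensenLattice

/-!
# `BalabanUV.Beta.GAN24.DerivativeRateTransferJensenFree` — binder row G-an2-4 ∕ (CONV-C), route R6 «VALUES, NOT DERIVATIVES», PART 26:
# THE FREE CASE ON THE BLOCK LATTICE — at `U = 1` (all transporters `1`) the block loops are flat, so (STAB) holds with constant EXACTLY 1 for the
# block-averaged free colour Laplacian tower: `⟨Qu, H_cQu⟩ ≤ ⟨u, H_fu⟩` and `(H_f − QᵀH_cQ).PosSemidef`; plus the PosSemidef packaging of the
# lattice holonomy case for PART 20 (unit b2b-balaban-gan24-p3, gen 37; v1.1 = v1 + `posSemidef_covJensen_holonomy_lattice`)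

NOT IN PRINT; OUR PROOF (for the ROUTE; [folklore] — PART 24 `covJensen_flat_lattice` BY NAME at `R = R′ = W = T = 1`).  HONEST FRAMING (cell contract,
verbatim): «discharging `BetaPertH` makes Bałaban's UV stability UNCONDITIONAL — a real constructive-QFT result; it is NOT the continuum limit and NOT the
Clay problem.»  HONEST DEPENDENCY (verbatim): «continuum YM on T⁴ ⇐ BetaPertH ∧ nine spine estimates (0/9 proved); BetaPertH ⇐ (D1) ∧ (D4) ∧ CAP+tail;
G-an2-4 gates asym, D1 and NE2/3/4.»

WHY THIS FILE.  The `U = 1` anchor of the covariant Jensen line, as a named theorem: PART 22 ∕ 24 at trivial transporters.  It is the site-field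
counterpart, in form language, of road P4's `U = 1` stability (`MonotoneTorusEffective.effAction_step_mono`, plaquette fields) and of the (1.67)-lower ∕
Federbush stability quoted in `gen36/R6-LOEWNER-NOTE.md` §2a — here for the free colour Laplacian `Σ_e |u(e⁺) − u(e⁻)|²` under plain block means
`(Qu)(y) = L^{−d}·Σ_{x ∈ B(y)} u(x)` on the block lattice of PART 24, with the (d−2)-scaling `w_c·L·(L·L^{−d}) ≤ w_f`.  No slack, no κ, no t.

WHAT THIS FILE PROVES (0 sorry, 0 `def`, nothing cited):
* **`jensen_free_lattice`** — `⟨Qu, H_cQu⟩ ≤ ⟨u, H_fu⟩` for every `u`, for ANY fine form dominating `w_f·Σ_e|u(tgt e) − u(src e)|²` and ANY coarse form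
  dominated by `w_c·Σ_{(y,μ)}|v(y + e_μ) − v(y)|²`, `Q` the plain block mean, `w_c·L·(L·(L^d)⁻¹) ≤ w_f`.
* **`posSemidef_jensen_free_lattice`** — the same as `(H_f − QᵀH_cQ).PosSemidef` for symmetric `H_f`, `H_c` (PART 18's (STAB) shape, constant 1).
* **`posSemidef_covJensen_holonomy_lattice`** — the PosSemidef packaging of PART 24's `covJensen_holonomy_lattice` (general orthogonal transporters,
  loops within κ): `((1+t)•H_f + ((1+t⁻¹)κ²w_c·(d·(L^d)⁻¹))•1 − QᵀH_cQ).PosSemidef` — PART 20's (STAB-ε,δ) with `G = 1` on the block lattice.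
SUPPLIER work on route R6 (rank 2, REDUCTION, no seat); no consumer of record; NEVER «G-an2-4 closed»; NOT (CONV-C), NOT D1, NOT `BetaPertH`, NOT
continuum, NOT Clay.  Records: `HOME/b2b-balaban-gan24-p3/WOODBURY-FIBRE.md` v13.7.
-/

noncomputable section

open Matrix Finset Function

namespace Summit.QuantumFields.BalabanUV.Beta.GAN24.DerivativeRateTransferJensenFree

open Summit.QuantumFields.BalabanUV.Beta.GAN24.DerivativeRateTransferLoewnerKKT (mulVec_dotProduct_eq)
open Summit.QuantumFields.BalabanUV.Beta.GAN24.DerivativeRateTransferJensenLattice (covJensen_flat_lattice covJensen_holonomy_lattice)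

variable {d L M : ℕ} {o : Type*} [Fintype o] [DecidableEq o]

/-- **`jensen_free_lattice` — (STAB) WITH CONSTANT EXACTLY 1 FOR THE FREE BLOCK-AVERAGED COLOUR LAPLACIAN** [our proof; PART 24 at trivial transporters].
Block lattice as in PART 24 (coarse `Fin d → ZMod M`, fine `(Fin d → ZMod M) × (Fin d → Fin L)`, fine bonds with carry); `Q` the plain block mean
(`(Qu)(y) = Σ_x [x.1 = y]·(L^d)⁻¹·u(x)`); `H_f ≥ w_f·Σ_e|u(tgt e) − u(src e)|²`, `H_c ≤ w_c·Σ_{(y,μ)}|v(y+e_μ) − v(y)|²`, `w_c·L·(L·(L^d)⁻¹) ≤ w_f`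
⟹ `⟨Qu, H_cQu⟩ ≤ ⟨u, H_fu⟩`. -/
theorem jensen_free_lattice [NeZero M] (hL : 0 < L)
    {Q : Matrix ((Fin d → ZMod M) × o) (((Fin d → ZMod M) × (Fin d → Fin L)) × o) ℝ}
    (hQ : ∀ (u : ((Fin d → ZMod M) × (Fin d → Fin L)) × o → ℝ) (y : Fin d → ZMod M),
      (fun a => (Q *ᵥ u) (y, a)) = ∑ x, (if x.1 = y then ((L : ℝ) ^ d)⁻¹ else 0) • (fun b => u (x, b)))
    {Hf : Matrix (((Fin d → ZMod M) × (Fin d → Fin L)) × o) (((Fin d → ZMod M) × (Fin d → Fin L)) × o) ℝ}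
    {Hc : Matrix ((Fin d → ZMod M) × o) ((Fin d → ZMod M) × o) ℝ} {wf wc : ℝ} (hwc : 0 ≤ wc)
    (hHc : ∀ v : (Fin d → ZMod M) × o → ℝ, v ⬝ᵥ (Hc *ᵥ v) ≤
      wc * ∑ e' : (Fin d → ZMod M) × Fin d, ((fun a => v (e'.1 + Pi.single e'.2 1, a)) - fun a => v (e'.1, a)) ⬝ᵥ
        ((fun a => v (e'.1 + Pi.single e'.2 1, a)) - fun a => v (e'.1, a)))
    (hHf : ∀ u : ((Fin d → ZMod M) × (Fin d → Fin L)) × o → ℝ,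
      wf * ∑ e : ((Fin d → ZMod M) × (Fin d → Fin L)) × Fin d,
        ((fun b => u ((e.1.1 + ((((e.1.2 e.2 : ℕ) + 1) / L) • (Pi.single e.2 (1 : ZMod M))),
            update e.1.2 e.2 ⟨((e.1.2 e.2 : ℕ) + 1) % L, Nat.mod_lt _ hL⟩), b)) - fun b => u (e.1, b)) ⬝ᵥ
          ((fun b => u ((e.1.1 + ((((e.1.2 e.2 : ℕ) + 1) / L) • (Pi.single e.2 (1 : ZMod M))),
            update e.1.2 e.2 ⟨((e.1.2 e.2 : ℕ) + 1) % L, Nat.mod_lt _ hL⟩), b)) - fun b => u (e.1, b)) ≤ u ⬝ᵥ (Hf *ᵥ u))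
    (hw : wc * L * (L * ((L : ℝ) ^ d)⁻¹) ≤ wf) (u : ((Fin d → ZMod M) × (Fin d → Fin L)) × o → ℝ) :
    (Q *ᵥ u) ⬝ᵥ (Hc *ᵥ (Q *ᵥ u)) ≤ u ⬝ᵥ (Hf *ᵥ u) := by
  have h1 : (1 : Matrix o o ℝ)ᵀ * 1 = 1 := by rw [transpose_one, Matrix.one_mul]
  refine covJensen_flat_lattice (o := o) (M := M) hL (R := fun _ => 1) (fun _ => h1) (R' := fun _ => 1) (W := fun _ _ => 1) (fun _ _ => h1)
    (Q := Q) ?_ (Hf := Hf) (Hc := Hc) (wf := wf) (wc := wc) hwc ?_ ?_ (T := fun _ _ _ => 1) (fun _ _ => rfl) (fun _ _ _ _ => by rw [Matrix.one_mul])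
    hw ?_ u
  · intro u' y; rw [hQ u' y]; simp only [one_mulVec]
  · intro v; simpa only [one_mulVec] using hHc v
  · intro u'; simpa only [one_mulVec] using hHf u'
  · intro e' x; simp only [transpose_one, Matrix.one_mul]

/-- **`posSemidef_jensen_free_lattice` — THE SAME AS PART 18's (STAB) SHAPE** [our proof]: with `H_f`, `H_c` symmetric, `(H_f − Qᵀ H_c Q).PosSemidef`. -/
theorem posSemidef_jensen_free_lattice [NeZero M] (hL : 0 < L)
    {Q : Matrix ((Fin d → ZMod M) × o) (((Fin d → ZMod M) × (Fin d → Fin L)) × o) ℝ}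
    (hQ : ∀ (u : ((Fin d → ZMod M) × (Fin d → Fin L)) × o → ℝ) (y : Fin d → ZMod M),
      (fun a => (Q *ᵥ u) (y, a)) = ∑ x, (if x.1 = y then ((L : ℝ) ^ d)⁻¹ else 0) • (fun b => u (x, b)))
    {Hf : Matrix (((Fin d → ZMod M) × (Fin d → Fin L)) × o) (((Fin d → ZMod M) × (Fin d → Fin L)) × o) ℝ}
    {Hc : Matrix ((Fin d → ZMod M) × o) ((Fin d → ZMod M) × o) ℝ} {wf wc : ℝ} (hwc : 0 ≤ wc) (hHfs : Hfᵀ = Hf) (hHcs : Hcᵀ = Hc)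
    (hHc : ∀ v : (Fin d → ZMod M) × o → ℝ, v ⬝ᵥ (Hc *ᵥ v) ≤
      wc * ∑ e' : (Fin d → ZMod M) × Fin d, ((fun a => v (e'.1 + Pi.single e'.2 1, a)) - fun a => v (e'.1, a)) ⬝ᵥ
        ((fun a => v (e'.1 + Pi.single e'.2 1, a)) - fun a => v (e'.1, a)))
    (hHf : ∀ u : ((Fin d → ZMod M) × (Fin d → Fin L)) × o → ℝ,
      wf * ∑ e : ((Fin d → ZMod M) × (Fin d → Fin L)) × Fin d,
        ((fun b => u ((e.1.1 + ((((e.1.2 e.2 : ℕ) + 1) / L) • (Pi.single e.2 (1 : ZMod M))),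
            update e.1.2 e.2 ⟨((e.1.2 e.2 : ℕ) + 1) % L, Nat.mod_lt _ hL⟩), b)) - fun b => u (e.1, b)) ⬝ᵥ
          ((fun b => u ((e.1.1 + ((((e.1.2 e.2 : ℕ) + 1) / L) • (Pi.single e.2 (1 : ZMod M))),
            update e.1.2 e.2 ⟨((e.1.2 e.2 : ℕ) + 1) % L, Nat.mod_lt _ hL⟩), b)) - fun b => u (e.1, b)) ≤ u ⬝ᵥ (Hf *ᵥ u))
    (hw : wc * L * (L * ((L : ℝ) ^ d)⁻¹) ≤ wf) :
    (Hf - Qᵀ * Hc * Q).PosSemidef := by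
  refine PosSemidef.of_dotProduct_mulVec_nonneg ?_ fun u => ?_
  · rw [Matrix.IsHermitian, Matrix.conjTranspose_eq_transpose_of_trivial, transpose_sub, hHfs, transpose_mul, transpose_mul,
      transpose_transpose, hHcs, Matrix.mul_assoc]
  · simp only [star_trivial, sub_mulVec, dotProduct_sub, sub_nonneg]
    have e : u ⬝ᵥ ((Qᵀ * Hc * Q) *ᵥ u) = (Q *ᵥ u) ⬝ᵥ (Hc *ᵥ (Q *ᵥ u)) := by
      rw [mulVec_dotProduct_eq, mulVec_mulVec, mulVec_mulVec, Matrix.mul_assoc]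
    rw [e]
    exact jensen_free_lattice hL hQ hwc hHc hHf hw u

/-- **`posSemidef_covJensen_holonomy_lattice` — (STAB-ε,δ) ON THE BLOCK LATTICE AS THE LOEWNER INEQUALITY PART 20 CONSUMES** [our proof; PART 24
`covJensen_holonomy_lattice` packaged]: data as there (orthogonal `R`, `R′`, `W`, partial transports `T`, loops within κ) with `H_f`, `H_c` symmetric; for every
`t > 0`: `((1 + t)•H_f + ((1 + t⁻¹)·κ²·w_c·(d·(L^d)⁻¹))•1 − QᵀH_cQ).PosSemidef`. -/
theorem posSemidef_covJensen_holonomy_lattice [NeZero M] (hL : 0 < L)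
    {R : ((Fin d → ZMod M) × (Fin d → Fin L)) × Fin d → Matrix o o ℝ} (hR : ∀ e, (R e)ᵀ * R e = 1)
    {R' : (Fin d → ZMod M) × Fin d → Matrix o o ℝ}
    {W : (Fin d → ZMod M) → (Fin d → ZMod M) × (Fin d → Fin L) → Matrix o o ℝ} (hW : ∀ y x, (W y x)ᵀ * W y x = 1)
    {Q : Matrix ((Fin d → ZMod M) × o) (((Fin d → ZMod M) × (Fin d → Fin L)) × o) ℝ}
    (hQ : ∀ (u : ((Fin d → ZMod M) × (Fin d → Fin L)) × o → ℝ) (y : Fin d → ZMod M),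
      (fun a => (Q *ᵥ u) (y, a)) = ∑ x, (if x.1 = y then ((L : ℝ) ^ d)⁻¹ else 0) • (W y x *ᵥ fun b => u (x, b)))
    {Hf : Matrix (((Fin d → ZMod M) × (Fin d → Fin L)) × o) (((Fin d → ZMod M) × (Fin d → Fin L)) × o) ℝ}
    {Hc : Matrix ((Fin d → ZMod M) × o) ((Fin d → ZMod M) × o) ℝ} {wf wc : ℝ} (hwc : 0 ≤ wc) (hHfs : Hfᵀ = Hf) (hHcs : Hcᵀ = Hc)
    (hHc : ∀ v : (Fin d → ZMod M) × o → ℝ, v ⬝ᵥ (Hc *ᵥ v) ≤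
      wc * ∑ e' : (Fin d → ZMod M) × Fin d, ((R' e' *ᵥ fun a => v (e'.1 + Pi.single e'.2 1, a)) - fun a => v (e'.1, a)) ⬝ᵥ
        ((R' e' *ᵥ fun a => v (e'.1 + Pi.single e'.2 1, a)) - fun a => v (e'.1, a)))
    (hHf : ∀ u : ((Fin d → ZMod M) × (Fin d → Fin L)) × o → ℝ,
      wf * ∑ e : ((Fin d → ZMod M) × (Fin d → Fin L)) × Fin d,
        ((R e *ᵥ fun b => u ((e.1.1 + ((((e.1.2 e.2 : ℕ) + 1) / L) • (Pi.single e.2 (1 : ZMod M))),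
            update e.1.2 e.2 ⟨((e.1.2 e.2 : ℕ) + 1) % L, Nat.mod_lt _ hL⟩), b)) - fun b => u (e.1, b)) ⬝ᵥ
          ((R e *ᵥ fun b => u ((e.1.1 + ((((e.1.2 e.2 : ℕ) + 1) / L) • (Pi.single e.2 (1 : ZMod M))),
            update e.1.2 e.2 ⟨((e.1.2 e.2 : ℕ) + 1) % L, Nat.mod_lt _ hL⟩), b)) - fun b => u (e.1, b)) ≤ u ⬝ᵥ (Hf *ᵥ u))
    {T : (Fin d → ZMod M) × Fin d → (Fin d → ZMod M) × (Fin d → Fin L) → ℕ → Matrix o o ℝ} (hT0 : ∀ e' x, T e' x 0 = 1)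
    (hT : ∀ e' x i, i < L → T e' x (i + 1) = T e' x i *
      R (((x.1 + (((x.2 e'.2 : ℕ) + i) / L) • (Pi.single e'.2 (1 : ZMod M)),
            update x.2 e'.2 ⟨((x.2 e'.2 : ℕ) + i) % L, Nat.mod_lt _ hL⟩) : (Fin d → ZMod M) × (Fin d → Fin L)), e'.2))
    (hw : wc * L * (L * ((L : ℝ) ^ d)⁻¹) ≤ wf) {κ : ℝ}
    (hV : ∀ e' x (w : o → ℝ),
      (((W e'.1 x)ᵀ * R' e' * W (e'.1 + Pi.single e'.2 1) (x.1 + Pi.single e'.2 1, x.2) * (T e' x L)ᵀ - 1) *ᵥ w) ⬝ᵥ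
          (((W e'.1 x)ᵀ * R' e' * W (e'.1 + Pi.single e'.2 1) (x.1 + Pi.single e'.2 1, x.2) * (T e' x L)ᵀ - 1) *ᵥ w) ≤ κ ^ 2 * (w ⬝ᵥ w))
    {t : ℝ} (ht : 0 < t) :
    ((1 + t) • Hf + ((1 + t⁻¹) * κ ^ 2 * wc * (d * ((L : ℝ) ^ d)⁻¹)) •
        (1 : Matrix (((Fin d → ZMod M) × (Fin d → Fin L)) × o) (((Fin d → ZMod M) × (Fin d → Fin L)) × o) ℝ) - Qᵀ * Hc * Q).PosSemidef := by
  refine PosSemidef.of_dotProduct_mulVec_nonneg ?_ fun u => ?_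
  · rw [Matrix.IsHermitian, Matrix.conjTranspose_eq_transpose_of_trivial, transpose_sub, transpose_add, transpose_smul, transpose_smul,
      transpose_one, hHfs, transpose_mul, transpose_mul, transpose_transpose, hHcs, Matrix.mul_assoc]
  · simp only [star_trivial, sub_mulVec, add_mulVec, dotProduct_sub, dotProduct_add, smul_mulVec, dotProduct_smul, smul_eq_mul,
      one_mulVec, sub_nonneg]
    have e : u ⬝ᵥ ((Qᵀ * Hc * Q) *ᵥ u) = (Q *ᵥ u) ⬝ᵥ (Hc *ᵥ (Q *ᵥ u)) := by
      rw [mulVec_dotProduct_eq, mulVec_mulVec, mulVec_mulVec, Matrix.mul_assoc]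
    rw [e]
    exact covJensen_holonomy_lattice hL hR hW hQ hwc hHc hHf hT0 hT hw hV ht u

end Summit.QuantumFields.BalabanUV.Beta.GAN24.DerivativeRateTransferJensenFree

end
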